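import Summits.BirchSwinnertonDyer.BirchSwinnertonDyer.Theorems.RamifiedSevenEllipticUnitsFrameDataOfGZK
import Summits.BirchSwinnertonDyer.BirchSwinnertonDyer.Theorems.CMRungInputs
import HarnessLib

set_option linter.dupNamespace false
set_option autoImplicit false

/-!
# Route `RamifiedSevenEllipticUnits` (rung K7r): the rung leaf from the THREE CRUXES and the
# published facts ALONE — the support item `FrameDataSeven` (stmt-BirchSwinnertonDyer-19146) is
# redundant in the route

Cell `bsd-cm`, seat `bsd-cm-ram` (g5). The route's deciding theorem `closes h₁ h₂ h₃ h₄ h₅` takes the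
frame data `h₄ : FrameDataSeven` as a separate (closed, hence un-closable: it needs `rank_ℤ = 1`) item.
But `h₅ : PublishedFactsSeven` already contains Gross–Zagier–Kolyvagin
(`rank_eq_analyticRank_of_analyticRank_le_one`, its 7th conjunct), and
`frameDataSeven_of_GZK` (p410208) constructs the frame data from exactly that. Hence:

* `cmRamifiedSeven_of_cruxes` :
  `EllipticUnitIndexSeven → StrictTorsionSeven → StrictControlSeven → PublishedFactsSeven → X12.CMRamifiedSeven`.

So the K7r leaf is the three O11 cruxes at `7` plus the published facts; a planner may drop item
`FrameDataSeven` from the route (`route edit`) with this theorem as the deciding composition, or keep it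
restated behind GZK. With `ellipticUnitIndexSeven_iff_strictControlSeven_of_bsdp` (p409726) the
independent content of the crux triple modulo `BSD(·,7)` on the isogeny classes is {(R-tors), one of
(R-EU)/(R-ctrl)}. Nothing is asserted; no named fact is minted; nothing closes.
-/

noncomputable section

namespace Summit.BirchSwinnertonDyer.BirchSwinnertonDyer.Theorems.RamifiedSevenEllipticUnits

open Summit.BirchSwinnertonDyer.BirchSwinnertonDyer.Theses.RamifiedSevenEllipticUnits in
/-- **K7r from the three cruxes and the published facts (no separate frame-data item).**
`(R-EU)@7 → (R-tors)@7 → (R-ctrl)@7 → PublishedFactsSeven → X12.CMRamifiedSeven`: the frame data is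
supplied by `frameDataSeven_of_GZK` from the GZK conjunct of `PublishedFactsSeven`, then the bridge
`CMRungInputs.cmRamifiedSeven_of_inputs` (p406906) applies. [cite: Darmon2004, Thm. 3.22 (= Thm. 1.14) and §3.9]
[cite: Miller2011LMS, §1 and Def. 1.1] -/
theorem cmRamifiedSeven_of_cruxes (h₁ : EllipticUnitIndexSeven) (h₂ : StrictTorsionSeven)
    (h₃ : StrictControlSeven) (h₅ : PublishedFactsSeven) :
    Summit.BirchSwinnertonDyer.Rank1Residual.X12.CMRamifiedSeven :=
  Summit.BirchSwinnertonDyer.BirchSwinnertonDyer.Rank1Residual.CMRungInputs.cmRamifiedSeven_of_inputs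
    h₁ h₂ h₃ (frameDataSeven_of_GZK h₅.2.2.2.2.2.2.1) h₅

end Summit.BirchSwinnertonDyer.BirchSwinnertonDyer.Theorems.RamifiedSevenEllipticUnits

end
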